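import Summits.QuantumFields.YangMills.Theorems.BalabanUVNodesN15KingModelSlicesDatum
import HarnessLib

/-!
# BalabanUVNodes ∕ N15 — THE KING-MODEL RUNG, CURVED EDITION (PART Ρ-e₂): PROPOSITION 3.7's SUP CLAUSES (3.63) FOR THE DATUM `kingSliceKernels` (part Ρ-e),
# every slice `0 ≤ j ≤ k − 1`, ONE `(C, δ₀)` for all levels, cubes and masses `0 < m² ≤ m₀²`
# (Track A, DAG node N15 = NE2; FAN-OUT v1.1 §N15 s3 «KING-MODEL RUNG … + the one-line statement of what the curved case adds»)

HONEST FRAMING.  Count-neutral (cell `pub-ymgap`, seat `pub-ymgap-dag-n15-e` g17; `--supports stmt-QuantumFields-27366 --as helper` = K3⁸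
`SpineGivenEndpointR13SepCoPHV`).  TEMPLATE LITERATURE, `A = 0`: C. King's scalar U(1)-Higgs MODEL on finite tori ([King1986] Prop. 3.7 (3.63) p. 663), NOT
Bałaban's covariant objects; NE2⁺ is NOT PRINTED for those and not proved; NOT a node discharge; nothing continuum ∕ ℝ⁴ ∕ OS ∕ mass-gap ∕ Clay.  0 `sorry`, 0 `def`.
The datum and its dictionary ((2.20)∕(2.17) APPLIED as the definition of the level-`k` kernels) are part Ρ-e's — HONEST SCOPE there.
* ★ `kingSliceKernels_ineq363_pos` (slices `1 ≤ j < k`: part Ρ-a `kingSliceG_abs_le`∕`kingSliceDG_abs_le` at the mass `m²(L^jη)² ≤ m₀²`, the weights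
  `(L^jη)^{2−D}`, `L^k(L^jη)^{2−D} = (L^jη)^{1−D}L^j`), ★ `kingSliceKernels_ineq363_zero` (`j = 0`: part Ρ-c `kingSliceZero_abs_le`∕`_step_le`, `L^kη^{2−D} = η^{1−D}`).
WHAT THE CURVED CASE ADDS (one line): (3.63) for `G_(j)(Ω, A)` — [King1986] §4 ∕ [Ba 4] (1.10) with `A ≠ 0`.
Locators: [King1986] Prop. 3.7 (3.63) p.663, (2.20) p.654, p.675; [Balaban1983RegularityDecay] Thm (1.10) p.573.
-/

noncomputable section

namespace Summit.QuantumFields.YangMills.BalabanUVNodes.N15KingModelRung.Curved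

open Real Finset Matrix
open Literature.MathematicalPhysics.QuantumFieldTheory.Balaban1983to89.B5Prop11Plancherel (Tor fine unitVec)
open Literature.MathematicalPhysics.QuantumFieldTheory.King1986 (aK aK_pos aK_le)
open Literature.MathematicalPhysics.QuantumFieldTheory.King1986.Torus (fineOp blockOf tdistT tdistT_nonneg tdistT_symm torCongr torCongr_add
  torCongr_unitVec tdistT_torCongr)
open Literature.MathematicalPhysics.QuantumFieldTheory.King1986.SlicePropagator (SliceKernels)

variable {d : ℕ} {L : ℕ} [NeZero L]

/-- **(3.63) FOR THE DATUM, SLICES `1 ≤ j ≤ k − 1`, BOTH DISPLAYS**: ONE `(C, δ₀)` for all levels, cubes, masses `0 < m² ≤ m₀²`.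
[cite: King1986, Prop. 3.7 (3.63) p.663, (2.20) p.654] -/
theorem kingSliceKernels_ineq363_pos (hLodd : Odd L) (hL : 2 ≤ L) {a : ℝ} (ha : 0 < a) {m0sq : ℝ} (hm0 : 0 ≤ m0sq) :
    ∃ C δ₀ : ℝ, 0 < C ∧ 0 < δ₀ ∧
    ∀ (k eM : ℕ) (hk : 1 ≤ k) (M : Fin (d + 1) → ℕ) [∀ μ, NeZero (M μ)] (hM : ∀ μ, M μ = 2 * L ^ eM)
      (msq : ℝ), 0 < msq → msq ≤ m0sq → ∀ (j : ℕ), 1 ≤ j → j < k → ∀ x y : Tor (fine (L ^ k) M),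
      |(kingSliceKernels L k eM M hM hk a msq).G j x y|
          ≤ C * ((kingSliceKernels L k eM M hM hk a msq).slice j) ^ ((2 : ℝ) - (d + 1 : ℕ))
              * Real.exp (-(δ₀ * ((kingSliceKernels L k eM M hM hk a msq).slice j)⁻¹ * (kingSliceKernels L k eM M hM hk a msq).dist x y)) ∧
      ∀ μ : Fin (d + 1), |(kingSliceKernels L k eM M hM hk a msq).dG j μ x y|
          ≤ C * ((kingSliceKernels L k eM M hM hk a msq).slice j) ^ ((1 : ℝ) - (d + 1 : ℕ))
              * Real.exp (-(δ₀ * ((kingSliceKernels L k eM M hM hk a msq).slice j)⁻¹ * (kingSliceKernels L k eM M hM hk a msq).dist x y)) := by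
  obtain ⟨C₁, δ₁, hC₁, hδ₁, H₁⟩ := kingSliceG_abs_le (d := d) L hLodd hL ha hm0
  obtain ⟨C₂, δ₂, hC₂, hδ₂, H₂⟩ := kingSliceDG_abs_le (d := d) L hLodd hL ha hm0
  have hL0 : (0 : ℝ) < L := by exact_mod_cast Nat.pos_of_ne_zero (NeZero.ne L)
  have hL1 : (1 : ℝ) ≤ L := by exact_mod_cast Nat.one_le_iff_ne_zero.mpr (NeZero.ne L)
  refine ⟨C₁ + C₂, min δ₁ δ₂, by positivity, lt_min hδ₁ hδ₂, ?_⟩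
  intro k eM hk M _ hM msq hmsq hcap j hj1 hjk x y
  have hLk : (0 : ℝ) < (L : ℝ) ^ k := pow_pos hL0 _
  have hmono : ∀ {δi w : ℝ}, min δ₁ δ₂ ≤ δi → 0 ≤ w → Real.exp (-(δi * w)) ≤ Real.exp (-(min δ₁ δ₂ * w)) := fun hle hw =>
    Real.exp_le_exp.mpr (neg_le_neg (mul_le_mul_of_nonneg_right hle hw))
  rw [kingSliceKernels_slice]
  simp only [kingSliceKernels_dist]
  rw [sliceWeight_eq hL0]
  simp only [kingSliceKernels_G, kingSliceKernels_dG]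
  have ht0 : 0 ≤ tdistT (fine (L ^ k) M) x y / (L : ℝ) ^ j := div_nonneg (tdistT_nonneg _ x y) (pow_pos hL0 _).le
  set s : ℝ := (L : ℝ) ^ j / (L : ℝ) ^ k with hsdef
  have hs : 0 < s := div_pos (pow_pos hL0 _) hLk
  have hs1 : s ≤ 1 := by rw [hsdef, div_le_one hLk]; exact pow_le_pow_right₀ hL1 hjk.le
  have hsD : 0 ≤ s ^ ((2 : ℝ) - (d + 1 : ℕ)) := Real.rpow_nonneg hs.le _
  have hsD' : 0 ≤ s ^ ((1 : ℝ) - (d + 1 : ℕ)) := Real.rpow_nonneg hs.le _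
  have hm : 0 < msq * s ^ 2 := by positivity
  have hs2 : s ^ 2 ≤ 1 := pow_le_one₀ hs.le hs1
  have hmc : msq * s ^ 2 ≤ m0sq := (mul_le_of_le_one_right hmsq.le hs2).trans hcap
  have hcar := kingSliceIdx_carrier (d := d) L M hM hj1 hjk
  have hC1 : C₁ ≤ C₁ + C₂ := le_add_of_nonneg_right hC₂.le
  have hC2 : C₂ ≤ C₁ + C₂ := le_add_of_nonneg_left hC₁.le
  have hC0 : 0 ≤ C₁ + C₂ := by positivity
  refine ⟨?_, fun μ => ?_⟩
  · rw [kingSliceG_of_pos M hM hk a msq hj1 hjk]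
    have h1 := H₁ (msq * s ^ 2) hm hmc k M (kingSliceIdx k eM j hj1) hcar x y
    generalize ksSlice L a (msq * s ^ 2) (kingSliceIdx k eM j hj1) (torCongr hcar x) (torCongr hcar y) = V at h1 ⊢
    set E₁ := Real.exp (-(δ₁ * (tdistT (fine (L ^ k) M) x y / (L : ℝ) ^ j))) with hE₁
    set E := Real.exp (-(min δ₁ δ₂ * (tdistT (fine (L ^ k) M) x y / (L : ℝ) ^ j))) with hE
    have hEE : E₁ ≤ E := hmono (min_le_left _ _) ht0
    rw [abs_mul, abs_of_nonneg hsD]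
    calc s ^ ((2 : ℝ) - (d + 1 : ℕ)) * |V| ≤ s ^ ((2 : ℝ) - (d + 1 : ℕ)) * (C₁ * E₁) := mul_le_mul_of_nonneg_left h1 hsD
      _ ≤ s ^ ((2 : ℝ) - (d + 1 : ℕ)) * ((C₁ + C₂) * E) :=
          mul_le_mul_of_nonneg_left (mul_le_mul hC1 hEE (Real.exp_nonneg _) hC0) hsD
      _ = (C₁ + C₂) * s ^ ((2 : ℝ) - (d + 1 : ℕ)) * E := by ring
  · rw [kingSliceG_of_pos M hM hk a msq hj1 hjk, kingSliceG_of_pos M hM hk a msq hj1 hjk, ← mul_sub]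
    have h2 := H₂ (msq * s ^ 2) hm hmc k M (kingSliceIdx k eM j hj1) hcar μ x y
    have hLjeq : ((L ^ (kingSliceIdx (d := d) k eM j hj1).j : ℕ) : ℝ) = (L : ℝ) ^ j := by
      rw [show (kingSliceIdx (d := d) k eM j hj1).j = j from rfl]; push_cast; ring
    rw [hLjeq] at h2
    generalize ksSlice L a (msq * s ^ 2) (kingSliceIdx k eM j hj1) (torCongr hcar (x + unitVec (fine (L ^ k) M) μ)) (torCongr hcar y)
      - ksSlice L a (msq * s ^ 2) (kingSliceIdx k eM j hj1) (torCongr hcar x) (torCongr hcar y) = Δ at h2 ⊢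
    set E₂ := Real.exp (-(δ₂ * (tdistT (fine (L ^ k) M) x y / (L : ℝ) ^ j))) with hE₂
    set E := Real.exp (-(min δ₁ δ₂ * (tdistT (fine (L ^ k) M) x y / (L : ℝ) ^ j))) with hE
    have hEE : E₂ ≤ E := hmono (min_le_right _ _) ht0
    have hLj : (0 : ℝ) < (L : ℝ) ^ j := pow_pos hL0 _
    have hexp : (L : ℝ) ^ k * s ^ ((2 : ℝ) - (d + 1 : ℕ)) = s ^ ((1 : ℝ) - (d + 1 : ℕ)) * (L : ℝ) ^ j := by
      have e1 : s ^ ((2 : ℝ) - (d + 1 : ℕ)) = s ^ ((1 : ℝ) - (d + 1 : ℕ)) * s := by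
        rw [rpow_mul_self_eq hs]; ring_nf
      rw [e1, hsdef]
      field_simp
    rw [abs_mul, abs_of_pos hLj] at h2
    rw [abs_mul, abs_mul, abs_of_pos hLk, abs_of_nonneg hsD, ← mul_assoc, hexp, mul_assoc]
    calc s ^ ((1 : ℝ) - (d + 1 : ℕ)) * ((L : ℝ) ^ j * |Δ|) ≤ s ^ ((1 : ℝ) - (d + 1 : ℕ)) * (C₂ * E₂) := mul_le_mul_of_nonneg_left h2 hsD'
      _ ≤ s ^ ((1 : ℝ) - (d + 1 : ℕ)) * ((C₁ + C₂) * E) :=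
          mul_le_mul_of_nonneg_left (mul_le_mul hC2 hEE (Real.exp_nonneg _) hC0) hsD'
      _ = (C₁ + C₂) * s ^ ((1 : ℝ) - (d + 1 : ℕ)) * E := by ring

/-- **(3.63) FOR THE DATUM, THE FINEST SLICE `j = 0`, BOTH DISPLAYS**. [cite: King1986, Prop. 3.7 (3.63) p.663, p.675 («When j = 0 …»)] -/
theorem kingSliceKernels_ineq363_zero (hLodd : Odd L) (hL : 2 ≤ L) {a : ℝ} (ha : 0 < a) {m0sq : ℝ} (hm0 : 0 ≤ m0sq) :
    ∃ C δ₀ : ℝ, 0 < C ∧ 0 < δ₀ ∧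
    ∀ (k eM : ℕ) (hk : 1 ≤ k) (M : Fin (d + 1) → ℕ) [∀ μ, NeZero (M μ)] (hM : ∀ μ, M μ = 2 * L ^ eM)
      (msq : ℝ), 0 < msq → msq ≤ m0sq → ∀ (j : ℕ), j = 0 → ∀ x y : Tor (fine (L ^ k) M),
      |(kingSliceKernels L k eM M hM hk a msq).G j x y|
          ≤ C * ((kingSliceKernels L k eM M hM hk a msq).slice j) ^ ((2 : ℝ) - (d + 1 : ℕ))
              * Real.exp (-(δ₀ * ((kingSliceKernels L k eM M hM hk a msq).slice j)⁻¹ * (kingSliceKernels L k eM M hM hk a msq).dist x y)) ∧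
      ∀ μ : Fin (d + 1), |(kingSliceKernels L k eM M hM hk a msq).dG j μ x y|
          ≤ C * ((kingSliceKernels L k eM M hM hk a msq).slice j) ^ ((1 : ℝ) - (d + 1 : ℕ))
              * Real.exp (-(δ₀ * ((kingSliceKernels L k eM M hM hk a msq).slice j)⁻¹ * (kingSliceKernels L k eM M hM hk a msq).dist x y)) := by
  obtain ⟨C₅, δ₅, hC₅, hδ₅, H₅⟩ := kingSliceZero_abs_le (d := d) L hLodd hL ha hm0
  have hL0 : (0 : ℝ) < L := by exact_mod_cast Nat.pos_of_ne_zero (NeZero.ne L)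
  have hL1 : (1 : ℝ) ≤ L := by exact_mod_cast Nat.one_le_iff_ne_zero.mpr (NeZero.ne L)
  set C : ℝ := 2 * (L : ℝ) ^ 2 * Real.exp δ₅ * C₅ with hCdef
  have hC : 0 < C := by positivity
  have hL2 : (1 : ℝ) ≤ (L : ℝ) ^ 2 := one_le_pow₀ hL1
  have he5 : (1 : ℝ) ≤ Real.exp δ₅ := Real.one_le_exp hδ₅.le
  have hc5 : (L : ℝ) ^ 2 * C₅ ≤ C := by
    rw [hCdef]
    have : (L : ℝ) ^ 2 * C₅ * 1 ≤ (L : ℝ) ^ 2 * C₅ * (2 * Real.exp δ₅) :=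
      mul_le_mul_of_nonneg_left (by linarith) (by positivity)
    linarith
  have hc5' : (L : ℝ) ^ 2 * (2 * Real.exp δ₅ * C₅) = C := by rw [hCdef]; ring
  refine ⟨C, δ₅, hC, hδ₅, ?_⟩
  intro k eM hk M _ hM msq hmsq hcap j hj0 x y
  subst hj0
  haveI := kingZeroVol_neZero (d := d) L k eM
  have hLk : (0 : ℝ) < (L : ℝ) ^ k := pow_pos hL0 _
  rw [kingSliceKernels_slice]
  simp only [kingSliceKernels_dist]
  rw [sliceWeight_eq hL0]
  simp only [kingSliceKernels_G, kingSliceKernels_dG]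
  set η : ℝ := (1 : ℝ) / (L : ℝ) ^ k with hηdef
  have hη : 0 < η := by positivity
  have hηD : 0 ≤ η ^ ((2 : ℝ) - (d + 1 : ℕ)) := Real.rpow_nonneg hη.le _
  have hηD' : 0 ≤ η ^ ((1 : ℝ) - (d + 1 : ℕ)) := Real.rpow_nonneg hη.le _
  have hm : 0 < msq * (L : ℝ) ^ 2 * η ^ 2 := by positivity
  have hLk1 : (L : ℝ) ≤ (L : ℝ) ^ k := by
    calc (L : ℝ) = (L : ℝ) ^ 1 := (pow_one _).symm
      _ ≤ (L : ℝ) ^ k := pow_le_pow_right₀ hL1 hk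
  have hLη : (L : ℝ) ^ 2 * η ^ 2 ≤ 1 := by
    rw [hηdef, ← mul_pow, div_eq_mul_inv, one_mul, ← div_eq_mul_inv]
    exact pow_le_one₀ (by positivity) ((div_le_one hLk).mpr hLk1)
  have hmc : msq * (L : ℝ) ^ 2 * η ^ 2 ≤ m0sq := by
    have : msq * ((L : ℝ) ^ 2 * η ^ 2) ≤ msq * 1 := mul_le_mul_of_nonneg_left hLη hmsq.le
    rw [mul_one, ← mul_assoc] at this
    exact this.trans hcap
  have h0car := kingZero_carrier (d := d) L M hM hk (eM := eM)
  have hslice0 : (L : ℝ) ^ 0 / (L : ℝ) ^ k = η := by rw [pow_zero, hηdef]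
  rw [hslice0, pow_zero]
  simp only [div_one]
  have hF : ∀ w : Tor (fine (L ^ k) M), |(fineOp (L ^ 1) (kingZeroVol L k eM) (aK a L 1) (((L ^ 1 : ℕ) : ℝ) ^ 2) (msq * (L : ℝ) ^ 2 * η ^ 2))⁻¹
      (torCongr h0car w) (torCongr h0car y)| ≤ C₅ * Real.exp (-(δ₅ * tdistT (fine (L ^ k) M) w y)) :=
    fun w => H₅ (msq * (L : ℝ) ^ 2 * η ^ 2) hm hmc k eM M (kingZeroVol L k eM) (fun _ => rfl) h0car w y
  have hL2pos : (0 : ℝ) < (L : ℝ) ^ 2 := by positivity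
  set E := Real.exp (-(δ₅ * tdistT (fine (L ^ k) M) x y)) with hE
  refine ⟨?_, fun μ => ?_⟩
  · rw [kingSliceG_zero M hM hk a msq]
    have h1 := hF x
    generalize (fineOp (L ^ 1) (kingZeroVol L k eM) (aK a L 1) (((L ^ 1 : ℕ) : ℝ) ^ 2) (msq * (L : ℝ) ^ 2 * η ^ 2))⁻¹
      (torCongr h0car x) (torCongr h0car y) = V at h1 ⊢
    rw [abs_mul, abs_of_nonneg hηD, abs_mul, abs_of_pos hL2pos]
    calc η ^ ((2 : ℝ) - (d + 1 : ℕ)) * ((L : ℝ) ^ 2 * |V|) ≤ η ^ ((2 : ℝ) - (d + 1 : ℕ)) * ((L : ℝ) ^ 2 * (C₅ * E)) :=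
          mul_le_mul_of_nonneg_left (mul_le_mul_of_nonneg_left h1 hL2pos.le) hηD
      _ = ((L : ℝ) ^ 2 * C₅) * η ^ ((2 : ℝ) - (d + 1 : ℕ)) * E := by ring
      _ ≤ C * η ^ ((2 : ℝ) - (d + 1 : ℕ)) * E := by
          exact mul_le_mul_of_nonneg_right (mul_le_mul_of_nonneg_right hc5 hηD) (Real.exp_nonneg _)
  · rw [kingSliceG_zero M hM hk a msq, kingSliceG_zero M hM hk a msq, ← mul_sub, ← mul_sub]
    have hstep := kingSliceZero_step_le (X := fine (L ^ k) M)
      (fun w => (fineOp (L ^ 1) (kingZeroVol L k eM) (aK a L 1) (((L ^ 1 : ℕ) : ℝ) ^ 2) (msq * (L : ℝ) ^ 2 * η ^ 2))⁻¹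
        (torCongr h0car w) (torCongr h0car y)) y hC₅.le hδ₅.le hF x μ
    generalize (fineOp (L ^ 1) (kingZeroVol L k eM) (aK a L 1) (((L ^ 1 : ℕ) : ℝ) ^ 2) (msq * (L : ℝ) ^ 2 * η ^ 2))⁻¹
        (torCongr h0car (x + unitVec (fine (L ^ k) M) μ)) (torCongr h0car y)
      - (fineOp (L ^ 1) (kingZeroVol L k eM) (aK a L 1) (((L ^ 1 : ℕ) : ℝ) ^ 2) (msq * (L : ℝ) ^ 2 * η ^ 2))⁻¹
        (torCongr h0car x) (torCongr h0car y) = Δ at hstep ⊢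
    have hexp : (L : ℝ) ^ k * η ^ ((2 : ℝ) - (d + 1 : ℕ)) = η ^ ((1 : ℝ) - (d + 1 : ℕ)) := by
      have e1 : η ^ ((2 : ℝ) - (d + 1 : ℕ)) = η ^ ((1 : ℝ) - (d + 1 : ℕ)) * η := by rw [rpow_mul_self_eq hη]; ring_nf
      rw [e1, hηdef]; field_simp
    rw [abs_mul, abs_mul, abs_mul, abs_of_pos hLk, abs_of_nonneg hηD, abs_of_pos hL2pos, ← mul_assoc, hexp]
    calc η ^ ((1 : ℝ) - (d + 1 : ℕ)) * ((L : ℝ) ^ 2 * |Δ|) ≤ η ^ ((1 : ℝ) - (d + 1 : ℕ)) * ((L : ℝ) ^ 2 * (2 * Real.exp δ₅ * C₅ * E)) :=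
          mul_le_mul_of_nonneg_left (mul_le_mul_of_nonneg_left hstep hL2pos.le) hηD'
      _ = C * η ^ ((1 : ℝ) - (d + 1 : ℕ)) * E := by rw [← hc5']; ring


end Summit.QuantumFields.YangMills.BalabanUVNodes.N15KingModelRung.Curved

end
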